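import Literature.Analysis.FluidPDE.LeiZhang2011HeatGauge
import Literature.Analysis.FluidPDE.LeiZhang2011RegularityProofs
import Literature.Analysis.FluidPDE.LeiZhang2011StreamLimit
import Literature.Analysis.FluidPDE.CaloricGradientBoxBounds
import Mathlib.Analysis.SpecialFunctions.JapaneseBracket
import HarnessLib

/-!
# Lei–Zhang 2011, Theorem 1.4 — the heat-flow gauge, II: the smoothed stream function

Analysis/FluidPDE **proofs file** (theorems only: no definitions, no named facts, no `sorry`)
on the discharge path of `Literature.Analysis.FluidPDE.LeiZhang2011_regularity_bmoStream`
(Z. Lei, Q. S. Zhang, J. Funct. Anal. 261 (2011) = arXiv:1011.5066, **Theorem 1.4**; see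
`LeiZhang2011HeatGauge` for the rôle of the gauge). For a locally integrable `g : ℝ³ → ℝ³` with
`‖g‖_{BMO} ≤ K` which is a *distributional* stream function of a bounded continuous field `w`
(`∫ φ ⟪w, e⟫ = ∫ ⟪g × ∇φ, e⟫` for `φ ∈ C¹_c`), the componentwise caloric extension
`G = e^{tΔ}g`, `G(y) = (e^{tΔ}g₀ (y), e^{tΔ}g₁ (y), e^{tΔ}g₂ (y))`, is

* differentiable, with `D G(y) v = (⟪∇e^{tΔ}gᵢ (y), v⟫)ᵢ` (`differentiable_heatGauge`);
* in `BMO` with `‖G‖_{BMO} ≤ ‖g‖_{BMO}` (`eBMOSeminormVec_heatGauge_le`, from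
  `eBMOSeminorm_heatExtension_le` componentwise: `⟪G, v⟫ = e^{tΔ}⟪g, v⟫`);
* a classical stream function of `e^{tΔ}w`: **`curl G = e^{tΔ}w`** (`curl_heatGauge`). This is
  Koch–Tataru's identity "the caloric extension of a divergence is the divergence of the caloric
  extensions" (the tree's fact (C) `heatExtension_eq_sum_inner_heatExtensionGrad_holds`) applied
  to `⟪w, eₖ⟫ = div (g × eₖ)`, followed by the coordinate algebra of the cross product.

## References

* Z. Lei, Q. S. Zhang, J. Funct. Anal. 261 (2011) = arXiv:1011.5066, Thm. 1.4 and §4.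
  [LeiZhang2011]
* H. Koch, D. Tataru, Adv. Math. 157 (2001), §4, proof of Theorem 1, first display.
  [KochTataruAdvMath2001]
-/

noncomputable section

open MeasureTheory Set Function Filter Topology Metric
open scoped InnerProductSpace RealInnerProductSpace NNReal ENNReal

namespace Literature.Analysis.FluidPDE

open Literature.Analysis.FunctionSpaces Literature.Analysis.FunctionSpaces.BMOInv

/-! ### Components of a `BMO` field -/

/-- The coordinates `z ↦ (g z)ₘ` of a locally integrable field with `‖g‖_{BMO} ≤ K` are `BMO`
functions with `‖gₘ‖_* ≤ K`. [folklore] -/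
theorem memBMO_apply_of_eBMOSeminormVec_le
    {g : EuclideanSpace ℝ (Fin 3) → EuclideanSpace ℝ (Fin 3)} (hg : LocallyIntegrable g volume)
    {K : ℝ≥0} (hK : eBMOSeminormVec g ≤ K) (m : Fin 3) :
    MemBMO (fun z => g z m) volume ∧ eBMOSeminorm (fun z => g z m) volume ≤ K := by
  have heq : (fun z => g z m) = fun z => ⟪g z, EuclideanSpace.single m (1 : ℝ)⟫ :=
    funext fun z => apply_eq_inner_single (g z) m
  rw [heq]
  refine ⟨memBMO_inner_of_eBMOSeminormVec_lt_top hg (hK.trans_lt ENNReal.coe_lt_top) _, ?_⟩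
  exact (le_iSup₂_of_le (EuclideanSpace.single m (1 : ℝ)) (by simp) le_rfl).trans hK

/-- Stein growth of the coordinates of a `BMO` field. [folklore] -/
theorem integrable_weight_mul_apply_of_eBMOSeminormVec_le
    {g : EuclideanSpace ℝ (Fin 3) → EuclideanSpace ℝ (Fin 3)} (hg : LocallyIntegrable g volume)
    {K : ℝ≥0} (hK : eBMOSeminormVec g ≤ K) (m : Fin 3) :
    Integrable (fun z : EuclideanSpace ℝ (Fin 3) =>
      ((1 + ‖z‖) ^ (Module.finrank ℝ (EuclideanSpace ℝ (Fin 3)) + 1))⁻¹ * g z m) volume :=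
  MemBMO.integrable_inv_one_add_norm_pow_mul_holds (memBMO_apply_of_eBMOSeminormVec_le hg hK m).1

/-! ### The smoothed stream function `G = e^{tΔ}g` (componentwise) -/

/-- **The componentwise caloric extension of a `BMO` field is differentiable**, with
`(D G(y) v)ᵢ = ⟪∇e^{tΔ}gᵢ (y), v⟫`. [folklore] -/
theorem differentiable_heatGauge
    {g : EuclideanSpace ℝ (Fin 3) → EuclideanSpace ℝ (Fin 3)} (hg : LocallyIntegrable g volume)
    {K : ℝ≥0} (hK : eBMOSeminormVec g ≤ K) {t : ℝ} (ht : 0 < t) :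
    Differentiable ℝ (fun y : EuclideanSpace ℝ (Fin 3) =>
      (WithLp.toLp 2 fun m : Fin 3 => heatExtension (fun z => g z m) t y :
        EuclideanSpace ℝ (Fin 3))) ∧
    ∀ (y v : EuclideanSpace ℝ (Fin 3)) (i : Fin 3),
      fderiv ℝ (fun y : EuclideanSpace ℝ (Fin 3) =>
        (WithLp.toLp 2 fun m : Fin 3 => heatExtension (fun z => g z m) t y :
          EuclideanSpace ℝ (Fin 3))) y v i =
        ⟪heatExtensionGrad (fun z => g z i) t y, v⟫ := by
  set G : EuclideanSpace ℝ (Fin 3) → EuclideanSpace ℝ (Fin 3) := fun y =>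
    WithLp.toLp 2 fun m : Fin 3 => heatExtension (fun z => g z m) t y with hG
  have hd := fun m => differentiable_heatExtension_of_memBMO
    (memBMO_apply_of_eBMOSeminormVec_le hg hK m).1 ht
  have hGi : ∀ i, (fun y => G y i) = heatExtension (fun z => g z i) t := fun i =>
    funext fun y => by simp [hG]
  have hGd : Differentiable ℝ G := by
    refine differentiable_euclidean.2 fun i => ?_
    rw [hGi]
    exact (hd i).1
  refine ⟨hGd, fun y v i => ?_⟩
  have h1 : HasFDerivAt (fun y => G y i)
      ((PiLp.proj 2 (fun _ : Fin 3 => ℝ) i).comp (fderiv ℝ G y)) y := by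
    have h := (PiLp.proj (𝕜 := ℝ) 2 (fun _ : Fin 3 => ℝ) i).hasFDerivAt.comp y
      (hGd y).hasFDerivAt
    exact h
  have h2 := (hd i).2 y v
  rw [← hGi i, h1.fderiv] at h2
  simpa using h2

/-- **The `BMO` seminorm of the smoothed stream**: `‖e^{tΔ}g‖_{BMO} ≤ ‖g‖_{BMO}`
(`⟪e^{tΔ}g (y), v⟫ = e^{tΔ}⟪g, v⟫ (y)` and `eBMOSeminorm_heatExtension_le`). [folklore] -/
theorem eBMOSeminormVec_heatGauge_le
    {g : EuclideanSpace ℝ (Fin 3) → EuclideanSpace ℝ (Fin 3)} (hg : LocallyIntegrable g volume)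
    {K : ℝ≥0} (hK : eBMOSeminormVec g ≤ K) {t : ℝ} (ht : 0 < t) :
    eBMOSeminormVec (fun y : EuclideanSpace ℝ (Fin 3) =>
      (WithLp.toLp 2 fun m : Fin 3 => heatExtension (fun z => g z m) t y :
        EuclideanSpace ℝ (Fin 3))) ≤ K := by
  refine iSup₂_le fun v hv => ?_
  -- `⟪G y, v⟫ = e^{tΔ}⟪g, v⟫ (y)`
  have hint : ∀ m y, Integrable (fun z => heatKernel t (y - z) * g z m) volume := fun m y =>
    integrable_heatKernel_mul_of_growth (integrable_weight_mul_apply_of_eBMOSeminormVec_le hg hK m)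
      ht y
  have heq : (fun y : EuclideanSpace ℝ (Fin 3) =>
      ⟪(WithLp.toLp 2 fun m : Fin 3 => heatExtension (fun z => g z m) t y :
        EuclideanSpace ℝ (Fin 3)), v⟫) = heatExtension (fun z => ⟪g z, v⟫) t := by
    funext y
    have h1 : ⟪(WithLp.toLp 2 fun m : Fin 3 => heatExtension (fun z => g z m) t y :
        EuclideanSpace ℝ (Fin 3)), v⟫ = ∑ m, v m * heatExtension (fun z => g z m) t y := by
      simp [PiLp.inner_apply]
    have h2 : (fun z => ⟪g z, v⟫) = fun z => ∑ m, v m * g z m := by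
      funext z
      simp [PiLp.inner_apply]
    rw [h1, h2]
    simp only [heatExtension]
    symm
    calc ∫ z, heatKernel t (y - z) * ∑ m, v m * g z m
        = ∫ z, ∑ m, v m * (heatKernel t (y - z) * g z m) :=
          integral_congr_ae (Eventually.of_forall fun z => by
            simp only [Finset.mul_sum]
            exact Finset.sum_congr rfl fun m _ => by ring)
      _ = ∑ m, ∫ z, v m * (heatKernel t (y - z) * g z m) :=
          integral_finsetSum _ fun m _ => (hint m y).const_mul (v m)
      _ = ∑ m, v m * ∫ z, heatKernel t (y - z) * g z m :=
          Finset.sum_congr rfl fun m _ => integral_const_mul _ _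
  rw [heq]
  have hmem : MemBMO (fun z => ⟪g z, v⟫) volume :=
    memBMO_inner_of_eBMOSeminormVec_lt_top hg (hK.trans_lt ENNReal.coe_lt_top) v
  exact (eBMOSeminorm_heatExtension_le hmem ht).trans ((le_iSup₂_of_le v hv le_rfl).trans hK)

/-! ### The distributional stream identity as a weak divergence -/

/-- `‖a × b‖ ≤ ‖a‖ ‖b‖` (a private copy of `norm_cross_le` of `PoincareHomotopyOperatorL2`, not
imported here). [folklore] -/
private theorem norm_cross_le_aux (a b : EuclideanSpace ℝ (Fin 3)) : ‖cross a b‖ ≤ ‖a‖ * ‖b‖ := by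
  rw [norm_cross]
  have h := Real.sin_le_one (InnerProductGeometry.angle a b)
  have h0 : 0 ≤ ‖a‖ * ‖b‖ := by positivity
  nlinarith

/-- `x ↦ g(x) × e` is locally integrable for a locally integrable `g`. [folklore] -/
theorem locallyIntegrable_cross_const
    {g : EuclideanSpace ℝ (Fin 3) → EuclideanSpace ℝ (Fin 3)} (hg : LocallyIntegrable g volume)
    (e : EuclideanSpace ℝ (Fin 3)) : LocallyIntegrable (fun x => cross (g x) e) volume := by
  have h1 : LocallyIntegrable (fun x => ‖e‖ • g x) volume := hg.smul ‖e‖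
  have hm : AEStronglyMeasurable (fun x => cross (g x) e) volume :=
    (crossCLM.flip e).continuous.comp_aestronglyMeasurable hg.aestronglyMeasurable
  refine h1.mono hm (Eventually.of_forall fun x => ?_)
  rw [norm_smul, norm_norm, mul_comm]
  exact norm_cross_le_aux _ _

/-- **The distributional stream identity in weak-divergence form**: if
`∫ φ ⟪w, e⟫ = ∫ ⟪g × ∇φ, e⟫` for all `φ ∈ C¹_c`, then `⟪w, e⟫ = div (g × e)` in `𝓓'`
(`⟪g × ∇φ, e⟫ = −⟪g × e, ∇φ⟫`). [folklore] -/
theorem hasWeakDivergenceRepresentation_inner_of_stream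
    {g w : EuclideanSpace ℝ (Fin 3) → EuclideanSpace ℝ (Fin 3)} (hg : LocallyIntegrable g volume)
    (hw : Continuous w)
    (hid : ∀ (φ : EuclideanSpace ℝ (Fin 3) → ℝ) (e : EuclideanSpace ℝ (Fin 3)),
      ContDiff ℝ 1 φ → HasCompactSupport φ →
        ∫ x, φ x * ⟪w x, e⟫ = ∫ x, ⟪cross (g x) (gradient φ x), e⟫)
    (e : EuclideanSpace ℝ (Fin 3)) :
    HasWeakDivergenceRepresentation (fun x => ⟪w x, e⟫) (fun x => cross (g x) e) where
  locallyIntegrable := (hw.inner continuous_const).locallyIntegrable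
  locallyIntegrable_field := locallyIntegrable_cross_const hg e
  integral_mul_eq φ hφ := by
    have h := hid φ e (hφ.contDiff.of_le (by exact_mod_cast le_top)) hφ.hasCompactSupport
    calc ∫ x, ⟪w x, e⟫ * φ x = ∫ x, φ x * ⟪w x, e⟫ :=
          integral_congr_ae (Eventually.of_forall fun x => mul_comm _ _)
      _ = ∫ x, ⟪cross (g x) (gradient φ x), e⟫ := h
      _ = ∫ x, -⟪cross (g x) e, gradient φ x⟫ :=
          integral_congr_ae (Eventually.of_forall fun x => by
            simp only [inner_cross_left_swap (g x) (gradient φ x) e])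
      _ = -∫ x, ⟪cross (g x) e, gradient φ x⟫ := integral_neg _

/-- Bounded measurable functions are tempered: `(1 + ‖y‖²)^{-2} u ∈ L¹(ℝ³)`. [folklore] -/
theorem exists_integrable_sq_weight_mul_of_bounded {u : EuclideanSpace ℝ (Fin 3) → ℝ}
    (hum : AEStronglyMeasurable u volume) {M : ℝ} (hM : ∀ x, |u x| ≤ M) :
    ∃ N : ℕ, Integrable (fun y : EuclideanSpace ℝ (Fin 3) => ((1 + ‖y‖ ^ 2) ^ N)⁻¹ * u y)
      volume := by
  refine ⟨2, ?_⟩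
  have hw : Integrable (fun y : EuclideanSpace ℝ (Fin 3) => ((1 + ‖y‖ ^ 2) ^ 2)⁻¹) volume := by
    have h := integrable_rpow_neg_one_add_norm_sq (E := EuclideanSpace ℝ (Fin 3))
      (μ := volume) (r := 4) (by rw [finrank_euclideanSpace_fin]; norm_num)
    refine h.congr (Eventually.of_forall fun y => ?_)
    have h0 : 0 ≤ 1 + ‖y‖ ^ 2 := by positivity
    show (1 + ‖y‖ ^ 2) ^ (-(4 : ℝ) / 2) = ((1 + ‖y‖ ^ 2) ^ 2)⁻¹
    rw [show -(4 : ℝ) / 2 = -(2 : ℝ) by norm_num, Real.rpow_neg h0, Real.rpow_two]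
  refine (hw.mul_const M).mono' (hw.aestronglyMeasurable.mul hum)
    (Eventually.of_forall fun y => ?_)
  have h0 : 0 ≤ ((1 + ‖y‖ ^ 2) ^ 2)⁻¹ := by positivity
  rw [norm_mul, Real.norm_of_nonneg h0, Real.norm_eq_abs]
  exact mul_le_mul_of_nonneg_left (hM y) h0

/-- **Koch–Tataru's fact (C) for the stream identity, in the standard coordinates of `ℝ³`**:
`e^{tΔ}⟪w, eₖ⟫ (y) = Σⱼ ⟪∇e^{tΔ}((g × eₖ)ⱼ) (y), eⱼ⟫`.
[cite: KochTataruAdvMath2001, §4, proof of Theorem 1, first display] -/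
theorem heatExtension_inner_single_eq_sum_of_stream
    {g w : EuclideanSpace ℝ (Fin 3) → EuclideanSpace ℝ (Fin 3)} (hg : LocallyIntegrable g volume)
    {K : ℝ≥0} (hK : eBMOSeminormVec g ≤ K) (hw : Continuous w) {M : ℝ} (hM : ∀ x, ‖w x‖ ≤ M)
    (hid : ∀ (φ : EuclideanSpace ℝ (Fin 3) → ℝ) (e : EuclideanSpace ℝ (Fin 3)),
      ContDiff ℝ 1 φ → HasCompactSupport φ →
        ∫ x, φ x * ⟪w x, e⟫ = ∫ x, ⟪cross (g x) (gradient φ x), e⟫)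
    {t : ℝ} (ht : 0 < t) (k : Fin 3) (y : EuclideanSpace ℝ (Fin 3)) :
    heatExtension (fun z => ⟪w z, EuclideanSpace.single k (1 : ℝ)⟫) t y =
      ∑ j : Fin 3, ⟪heatExtensionGrad (fun z =>
        ⟪cross (g z) (EuclideanSpace.single k (1 : ℝ)), EuclideanSpace.single j (1 : ℝ)⟫) t y,
          EuclideanSpace.single j (1 : ℝ)⟫ := by
  set ek : EuclideanSpace ℝ (Fin 3) := EuclideanSpace.single k (1 : ℝ) with hek
  have hdiv := hasWeakDivergenceRepresentation_inner_of_stream hg hw hid ek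
  have htemp : ∃ N : ℕ, Integrable (fun y : EuclideanSpace ℝ (Fin 3) =>
      ((1 + ‖y‖ ^ 2) ^ N)⁻¹ * ⟪w y, ek⟫) volume := by
    refine exists_integrable_sq_weight_mul_of_bounded
      (hw.inner continuous_const).aestronglyMeasurable (M := M * ‖ek‖) fun x => ?_
    exact (abs_real_inner_le_norm _ _).trans (mul_le_mul_of_nonneg_right (hM x) (norm_nonneg _))
  have hΦ : ∀ v : EuclideanSpace ℝ (Fin 3), Integrable (fun y : EuclideanSpace ℝ (Fin 3) =>
      ((1 + ‖y‖) ^ (Module.finrank ℝ (EuclideanSpace ℝ (Fin 3)) + 1))⁻¹ *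
        ⟪cross (g y) ek, v⟫) volume := fun v => by
    have h := MemBMO.integrable_inv_one_add_norm_pow_mul_holds
      (memBMO_inner_of_eBMOSeminormVec_lt_top hg (hK.trans_lt ENNReal.coe_lt_top) (cross ek v))
    refine h.congr (Eventually.of_forall fun y => ?_)
    simp only [inner_cross_right_eq_inner_cross_left]
  -- fact (C) in the reindexed standard basis
  have hfin : Module.finrank ℝ (EuclideanSpace ℝ (Fin 3)) = 3 := finrank_euclideanSpace_fin
  set b : OrthonormalBasis (Fin (Module.finrank ℝ (EuclideanSpace ℝ (Fin 3)))) ℝ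
    (EuclideanSpace ℝ (Fin 3)) :=
    (EuclideanSpace.basisFun (Fin 3) ℝ).reindex (finCongr hfin.symm) with hb
  have hC := heatExtension_eq_sum_inner_heatExtensionGrad_holds hdiv htemp hΦ b ht y
  rw [hC, ← Equiv.sum_comp (finCongr hfin.symm)]
  refine Finset.sum_congr rfl fun j _ => ?_
  have hbj : b (finCongr hfin.symm j) = EuclideanSpace.single j (1 : ℝ) := by
    rw [hb, OrthonormalBasis.reindex_apply, Equiv.symm_apply_apply, EuclideanSpace.basisFun_apply]
  rw [hbj]

/-! ### The curl of the smoothed stream -/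

/-- The coordinates of `a × eₖ` paired with `eⱼ`. [folklore] -/
theorem inner_cross_single_single (a : EuclideanSpace ℝ (Fin 3)) (k j : Fin 3) :
    ⟪cross a (EuclideanSpace.single k (1 : ℝ)), EuclideanSpace.single j (1 : ℝ)⟫ =
      ![![0, a 2, -a 1], ![-a 2, 0, a 0], ![a 1, -a 0, 0]] k j := by
  rw [← apply_eq_inner_single]
  fin_cases k <;> fin_cases j <;> simp [cross, cross_apply]

/-- The coordinates of the curl. [folklore] -/
theorem curl_apply_eq (v : EuclideanSpace ℝ (Fin 3) → EuclideanSpace ℝ (Fin 3))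
    (x : EuclideanSpace ℝ (Fin 3)) :
    curl v x 0 = fderiv ℝ v x (EuclideanSpace.single 1 1) 2 -
        fderiv ℝ v x (EuclideanSpace.single 2 1) 1 ∧
      curl v x 1 = fderiv ℝ v x (EuclideanSpace.single 2 1) 0 -
        fderiv ℝ v x (EuclideanSpace.single 0 1) 2 ∧
      curl v x 2 = fderiv ℝ v x (EuclideanSpace.single 0 1) 1 -
        fderiv ℝ v x (EuclideanSpace.single 1 1) 0 := by
  simp [curl]

/-- `∇e^{tΔ}(−f) = −∇e^{tΔ}f`. [folklore] -/
theorem heatExtensionGrad_neg {E : Type*} [NormedAddCommGroup E] [InnerProductSpace ℝ E]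
    [FiniteDimensional ℝ E] [MeasurableSpace E] [BorelSpace E] (f : E → ℝ) (t : ℝ) (y : E) :
    heatExtensionGrad (fun z => -f z) t y = -heatExtensionGrad f t y := by
  simp only [heatExtensionGrad, neg_smul, integral_neg]

/-- **The curl of the smoothed stream is the caloric extension of the velocity**:
`curl (e^{tΔ}g) = e^{tΔ}w` when `g ∈ BMO` is a distributional stream function of the bounded
continuous field `w` (`∫ φ ⟪w, e⟫ = ∫ ⟪g × ∇φ, e⟫` for `φ ∈ C¹_c`). Koch–Tataru's identity
`e^{tΔ} div = div e^{tΔ}` for `⟪w, eₖ⟫ = div (g × eₖ)`, and `(g × e₀, g × e₁, g × e₂)` in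
coordinates. [cite: KochTataruAdvMath2001, §4, proof of Theorem 1, first display] -/
theorem curl_heatGauge
    {g w : EuclideanSpace ℝ (Fin 3) → EuclideanSpace ℝ (Fin 3)} (hg : LocallyIntegrable g volume)
    {K : ℝ≥0} (hK : eBMOSeminormVec g ≤ K) (hw : Continuous w) {M : ℝ} (hM : ∀ x, ‖w x‖ ≤ M)
    (hid : ∀ (φ : EuclideanSpace ℝ (Fin 3) → ℝ) (e : EuclideanSpace ℝ (Fin 3)),
      ContDiff ℝ 1 φ → HasCompactSupport φ →
        ∫ x, φ x * ⟪w x, e⟫ = ∫ x, ⟪cross (g x) (gradient φ x), e⟫)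
    {t : ℝ} (ht : 0 < t) (y : EuclideanSpace ℝ (Fin 3)) :
    curl (fun y : EuclideanSpace ℝ (Fin 3) =>
      (WithLp.toLp 2 fun m : Fin 3 => heatExtension (fun z => g z m) t y :
        EuclideanSpace ℝ (Fin 3))) y =
      Literature.Analysis.UnboundedOperators.heatExtension w t y := by
  obtain ⟨-, hD⟩ := differentiable_heatGauge hg hK ht
  -- the right-hand side, componentwise
  have hwmem : MemLp w ⊤ volume :=
    memLp_top_of_bound hw.aestronglyMeasurable M (Eventually.of_forall hM)
  have hR : ∀ k : Fin 3, (Literature.Analysis.UnboundedOperators.heatExtension w t y) k =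
      heatExtension (fun z => ⟪w z, EuclideanSpace.single k (1 : ℝ)⟫) t y := fun k => by
    rw [apply_eq_inner_single, ← heatExtension_inner_const_apply hwmem le_top ht y,
      Literature.Analysis.UnboundedOperators.heatExtension_eq_integral_sub]
    rfl
  have hC := fun k => heatExtension_inner_single_eq_sum_of_stream hg hK hw hM hid ht k y
  have hM' : ∀ k j : Fin 3, (fun z : EuclideanSpace ℝ (Fin 3) =>
      ⟪cross (g z) (EuclideanSpace.single k (1 : ℝ)), EuclideanSpace.single j (1 : ℝ)⟫) =
        fun z => ![![0, g z 2, -g z 1], ![-g z 2, 0, g z 0], ![g z 1, -g z 0, 0]] k j :=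
    fun k j => funext fun z => inner_cross_single_single (g z) k j
  obtain ⟨h0, h1, h2⟩ := curl_apply_eq (fun y : EuclideanSpace ℝ (Fin 3) =>
    (WithLp.toLp 2 fun m : Fin 3 => heatExtension (fun z => g z m) t y :
      EuclideanSpace ℝ (Fin 3))) y
  have hcomp : ∀ (f : EuclideanSpace ℝ (Fin 3) → ℝ) (j : Fin 3),
      ⟪heatExtensionGrad f t y, EuclideanSpace.single j (1 : ℝ)⟫ = heatExtensionGrad f t y j :=
    fun f j => (apply_eq_inner_single _ j).symm
  ext k
  fin_cases k
  · simp only [Fin.zero_eta, Fin.isValue]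
    rw [h0, hD, hD, hR 0, hC 0, Fin.sum_univ_three, hM', hM', hM']
    simp only [Fin.isValue, Matrix.cons_val_zero, Matrix.cons_val_one, Matrix.cons_val_two,
      Matrix.head_cons, Matrix.tail_cons, heatExtensionGrad_const, heatExtensionGrad_neg,
      inner_zero_left, inner_neg_left, hcomp]
    ring
  · simp only [Fin.mk_one, Fin.isValue]
    rw [h1, hD, hD, hR 1, hC 1, Fin.sum_univ_three, hM', hM', hM']
    simp only [Fin.isValue, Matrix.cons_val_zero, Matrix.cons_val_one, Matrix.cons_val_two,
      Matrix.head_cons, Matrix.tail_cons, heatExtensionGrad_const, heatExtensionGrad_neg,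
      inner_zero_left, inner_neg_left, hcomp]
    ring
  · simp only [Fin.reduceFinMk, Fin.isValue]
    rw [h2, hD, hD, hR 2, hC 2, Fin.sum_univ_three, hM', hM', hM']
    simp only [Fin.isValue, Matrix.cons_val_zero, Matrix.cons_val_one, Matrix.cons_val_two,
      Matrix.head_cons, Matrix.tail_cons, heatExtensionGrad_const, heatExtensionGrad_neg,
      inner_zero_left, inner_neg_left, hcomp]
    ring

end Literature.Analysis.FluidPDE
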